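import Summits.QuantumFields.QCD.Theses.QuarksAsStableAction

/-!
# Invertibility of the diagonal block of the time-sliced Wilson matrix
(helper for crux stmt-QuantumFields-9737, line `Sketch` — F3-core STEP β, stub
`isUnit_det_projChainBlock`)

After the projector-chain substitution the time-sliced `r = 1` Wilson fermion matrix is block
bidiagonal cyclic with diagonal blocks `E_t = A_t P⁻ − P⁺ W′_{t−1}` (slice operator `A_t`, backward
temporal hop `W′`, Wilson time projections `P± = ½ (1 ± γ₀)`).  In `±` components
`E = [[−W′|₊, A₊₋], [0, A₋₋]]` is block triangular, hence invertible as soon as the backward hop `W′`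
and the spin-blind part `A₋₋ = B ⊗ 1` are.

Abstract form proved here (`isUnit_det_projChainBlock`): for complementary projections
`P⁺ + P⁻ = 1`, `P⁺ P⁻ = P⁻ P⁺ = 0`, a slice operator `A` with `P⁻ A P⁻ = Â_b P⁻` where the
"spin-blind part" `Â_b` commutes with `P⁻` and is invertible, and a hop `W′` commuting with `P⁺` and
invertible, the block `E = A P⁻ − P⁺ W′` has invertible determinant.

Proof: `E` has trivial kernel.  If `E x = 0` then `P⁻ E = P⁻ A P⁻ = Â_b P⁻` (as `P⁻ P⁺ = 0`) gives
`Â_b (P⁻ x) = 0`, so `P⁻ x = 0`; then `E x = −P⁺ W′ x = −W′ (P⁺ x) = 0` gives `P⁺ x = 0`, whence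
`x = (P⁺ + P⁻) x = 0`.  Injectivity of `E.mulVec` is equivalent to `IsUnit E` over a field
(`Matrix.mulVec_injective_iff_isUnit`), i.e. to `IsUnit E.det`.
[cite: Luscher1977, pp. 283–292]; Smit, *Introduction to Quantum Fields on a Lattice*, §6.5 (prose
mention).  Pure linear algebra over Mathlib; pure theorem file (no definitions).
-/

noncomputable section

namespace Summit.QuantumFields.QCD.Cruxes.StableActionBridge.Sketch

namespace ProjChainBlock

open scoped Matrix

/-- **Trivial kernel of the diagonal block.**  For complementary projections `Pp + Pm = 1` with
`Pm Pp = 0`, a slice operator `A` with `Pm A Pm = Ab Pm`, `Ab` acting injectively, and a hop `W'`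
commuting with `Pp` and acting injectively, the block `A Pm − Pp W'` has trivial kernel. -/
theorem mulVec_eq_zero_imp {k : Type*} [Fintype k] [DecidableEq k] (A Ab W' Pp Pm : Matrix k k ℂ)
    (hsum : Pp + Pm = 1) (hmp : Pm * Pp = 0) (hA : Pm * A * Pm = Ab * Pm)
    (hAbinj : Function.Injective Ab.mulVec) (hW' : W' * Pp = Pp * W')
    (hW'inj : Function.Injective W'.mulVec) (x : k → ℂ) (hx : (A * Pm - Pp * W') *ᵥ x = 0) :
    x = 0 := by
  -- Step 1: the `Pm`-component of `x` vanishes, by invertibility of the spin-blind part `Ab`.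
  have hPmE : Pm * (A * Pm - Pp * W') = Ab * Pm := by
    rw [Matrix.mul_sub, ← Matrix.mul_assoc, ← Matrix.mul_assoc, hmp, zero_mul, sub_zero, hA]
  have h1 : Pm *ᵥ x = 0 := by
    apply hAbinj
    rw [Matrix.mulVec_zero, Matrix.mulVec_mulVec, ← hPmE, ← Matrix.mulVec_mulVec, hx,
      Matrix.mulVec_zero]
  -- Step 2: the `Pp`-component of `x` vanishes, by invertibility of the hop `W'`.
  have h2 : Pp *ᵥ x = 0 := by
    apply hW'inj
    rw [Matrix.mulVec_zero, Matrix.mulVec_mulVec, hW', ← Matrix.mulVec_mulVec]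
    rw [Matrix.sub_mulVec, ← Matrix.mulVec_mulVec, h1, Matrix.mulVec_zero, zero_sub, neg_eq_zero,
      ← Matrix.mulVec_mulVec] at hx
    exact hx
  -- Step 3: `x = (Pp + Pm) x = 0`.
  calc x = (Pp + Pm) *ᵥ x := by rw [hsum, Matrix.one_mulVec]
    _ = 0 := by rw [Matrix.add_mulVec, h1, h2, add_zero]

end ProjChainBlock

/-- **Invertibility of the diagonal block `E = A P⁻ − P⁺ W′`** (stub `isUnit_det_projChainBlock` of
line `Sketch`, F3-core STEP β): for complementary projections `Pp + Pm = 1`, `Pp Pm = Pm Pp = 0`,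
a slice operator `A` whose `Pm`-corner is spin blind, `Pm A Pm = Ab Pm` with `Ab` commuting with `Pm`
and `det Ab` a unit, and a hop `W'` commuting with `Pp` with `det W'` a unit, the determinant of
`A Pm − Pp W'` is a unit. -/
theorem isUnit_det_projChainBlock :
    ∀ (k : Type) [Fintype k] [DecidableEq k] (A Ab W' Pp Pm : Matrix k k ℂ),
      Pp + Pm = 1 → Pp * Pm = 0 → Pm * Pp = 0 → Pm * A * Pm = Ab * Pm → Ab * Pm = Pm * Ab →
      IsUnit Ab.det → W' * Pp = Pp * W' → IsUnit W'.det → IsUnit (A * Pm - Pp * W').det := by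
  intro k _ _ A Ab W' Pp Pm hsum _hpm hmp hA _hAb hAbdet hW' hW'det
  have hAbinj : Function.Injective Ab.mulVec :=
    Matrix.mulVec_injective_of_isUnit ((Matrix.isUnit_iff_isUnit_det _).2 hAbdet)
  have hW'inj : Function.Injective W'.mulVec :=
    Matrix.mulVec_injective_of_isUnit ((Matrix.isUnit_iff_isUnit_det _).2 hW'det)
  rw [← Matrix.isUnit_iff_isUnit_det, ← Matrix.mulVec_injective_iff_isUnit, ← Matrix.coe_mulVecLin,
    ← LinearMap.ker_eq_bot, Matrix.ker_mulVecLin_eq_bot_iff]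
  exact ProjChainBlock.mulVec_eq_zero_imp A Ab W' Pp Pm hsum hmp hA hAbinj hW' hW'inj

end Summit.QuantumFields.QCD.Cruxes.StableActionBridge.Sketch

end
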